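import Summits.AnomalousDissipation.AnomalousDissipation.Theorems.SawtoothPulseCascadeK1LocalisedCascadeLedgerFeedChain

/-!
# K1loc, line `Spectral` / thin start — helper: THE RESOLVED LEDGER WITH GEOMETRIC AMPLITUDES (closed-form budget)

Helper file of the prover lane on the crux `K1LocalisedCascade` (stmt-AnomalousDissipation-19491), route `SawtoothPulseCascade`
(glue seat; numeric layer — the bridge between the per-phase geometric bounds of `…PhaseSums`/`…CanonicalRatioSteps`/… and the
closer `K1Ledger.From.k1Localised_of_resolved_ledger` of `…LedgerFeedChain`).  The resolved per-phase increment is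
  `e_j = w^T_j² + 2w^T_j·o_j + (w^S_j + w^{C1}_j + 𝔞¹_j + √f^{C1}_j)² + (w^O_j + w^{C2}_j + 𝔞²_j + √f^{C2}_j)² + f^S_j + f^T_j + f^O_j`;
the closer wants `Summable e` and the budget `S_{j₀} + O_{j₀} + Σ'_i e_{j₀+i} < ‖datum‖²`.  Here:
* `resolved_junk_le_geometric`: if every AMPLITUDE decays geometrically from the start phase — `w^•_{j₀+i}, 𝔞^•_{j₀+i},
  √f^{C•}_{j₀+i} ≤ (const)·θ^i` — the far ENERGIES satisfy `f^•_{j₀+i} ≤ (const)·θ^i`, and `o_{j₀+i} ≤ ō` (bounded), then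
  `e_{j₀+i} ≤ C_e·θ^i` with the explicit
  `C_e = α_T² + 2α_Tō + (α_S + α_{C1} + β₁ + ψ₁)² + (α_O + α_{C2} + β₂ + ψ₂)² + φ_S + φ_T + φ_O`;
* `summable_and_tsum_le_of_shift_geometric`: hence `e` is summable and `Σ'_i e_{j₀+i} ≤ C_e/(1−θ)`;
* **`k1Localised_of_resolved_ledger_geometric`**: the closer with `hes`/`hbudget` replaced by the geometric amplitude bounds and the
  CLOSED-FORM budget `S_{j₀} + O_{j₀} + C_e/(1−θ) < ‖datum‖²`.
Pure real bookkeeping; no definitions; nothing about `δ₀ = ¼`. [cite: DEIJ2022, (1.2)–(1.3)] [cite: Grafakos2014, Prop. 3.2.7 (3)] [problem: turb]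
-/

-- `Summit.<Summit>.<Problem>`: single-conjunct summit, the duplicate namespace segment is deliberate.
set_option linter.dupNamespace false

noncomputable section

namespace Summit.AnomalousDissipation.AnomalousDissipation.Theorems.SawtoothPulseCascade.K1Ledger.From

open MeasureTheory Set Filter Topology UnitAddTorus Function
open scoped ENNReal
open Literature.Analysis Literature.Analysis.FunctionSpaces Literature.Analysis.FunctionSpaces.Torus Literature.Analysis.FluidPDE
open Literature.Analysis.FluidPDE.ShearStage
open Literature.Analysis.FluidPDE.SawtoothCascade Literature.Analysis.FluidPDE.SawtoothCascade.CascadeParams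
open Summit.AnomalousDissipation.AnomalousDissipation.Theorems.SawtoothPulseCascade.K1Window

/-! ## §1 The resolved junk energy under geometric amplitude bounds -/

/-- **THE RESOLVED JUNK ENERGY IS GEOMETRIC** when its amplitudes are: with `0 ≤ θ ≤ 1`, amplitude bounds
`0 ≤ w^T ≤ α_Tθ^i`, `0 ≤ w^S ≤ α_Sθ^i`, `0 ≤ w^O ≤ α_Oθ^i`, `0 ≤ w^{C1} ≤ α₁θ^i`, `0 ≤ w^{C2} ≤ α₂θ^i`, `0 ≤ 𝔞¹ ≤ β₁θ^i`,
`0 ≤ 𝔞² ≤ β₂θ^i`, `√f^{C1} ≤ ψ₁θ^i`, `√f^{C2} ≤ ψ₂θ^i`, a bounded off-cone amplitude `0 ≤ o ≤ ō`, and far energies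
`f^S ≤ φ_Sθ^i`, `f^T ≤ φ_Tθ^i`, `f^O ≤ φ_Oθ^i` (all at phase `j₀ + i`), the increment of `strip_offCone_resolved_step` satisfies
`e_{j₀+i} ≤ C_e·θ^i`, `C_e = α_T² + 2α_Tō + (α_S + α₁ + β₁ + ψ₁)² + (α_O + α₂ + β₂ + ψ₂)² + φ_S + φ_T + φ_O`. [folklore] -/
theorem resolved_junk_le_geometric {wS wT wO wC₁ wC₂ 𝔞₁ 𝔞₂ o fS fT fO fC₁ fC₂ : ℕ → ℝ} {j₀ : ℕ}
    {θ αS αT αO α₁ α₂ β₁ β₂ ψ₁ ψ₂ ob φS φT φO : ℝ} (hθ0 : 0 ≤ θ) (hθ1 : θ ≤ 1)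
    (hwT0 : ∀ i, 0 ≤ wT (j₀ + i)) (hwT : ∀ i, wT (j₀ + i) ≤ αT * θ ^ i)
    (hwS0 : ∀ i, 0 ≤ wS (j₀ + i)) (hwS : ∀ i, wS (j₀ + i) ≤ αS * θ ^ i)
    (hwO0 : ∀ i, 0 ≤ wO (j₀ + i)) (hwO : ∀ i, wO (j₀ + i) ≤ αO * θ ^ i)
    (hwC₁0 : ∀ i, 0 ≤ wC₁ (j₀ + i)) (hwC₁ : ∀ i, wC₁ (j₀ + i) ≤ α₁ * θ ^ i)
    (hwC₂0 : ∀ i, 0 ≤ wC₂ (j₀ + i)) (hwC₂ : ∀ i, wC₂ (j₀ + i) ≤ α₂ * θ ^ i)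
    (h𝔞₁0 : ∀ i, 0 ≤ 𝔞₁ (j₀ + i)) (h𝔞₁ : ∀ i, 𝔞₁ (j₀ + i) ≤ β₁ * θ ^ i)
    (h𝔞₂0 : ∀ i, 0 ≤ 𝔞₂ (j₀ + i)) (h𝔞₂ : ∀ i, 𝔞₂ (j₀ + i) ≤ β₂ * θ ^ i)
    (hψ₁ : ∀ i, Real.sqrt (fC₁ (j₀ + i)) ≤ ψ₁ * θ ^ i) (hψ₂ : ∀ i, Real.sqrt (fC₂ (j₀ + i)) ≤ ψ₂ * θ ^ i)
    (ho0 : ∀ i, 0 ≤ o (j₀ + i)) (ho : ∀ i, o (j₀ + i) ≤ ob)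
    (hfS : ∀ i, fS (j₀ + i) ≤ φS * θ ^ i) (hfT : ∀ i, fT (j₀ + i) ≤ φT * θ ^ i) (hfO : ∀ i, fO (j₀ + i) ≤ φO * θ ^ i)
    (i : ℕ) :
    wT (j₀ + i) ^ 2 + 2 * wT (j₀ + i) * o (j₀ + i) +
          (wS (j₀ + i) + wC₁ (j₀ + i) + 𝔞₁ (j₀ + i) + Real.sqrt (fC₁ (j₀ + i))) ^ 2 +
          (wO (j₀ + i) + wC₂ (j₀ + i) + 𝔞₂ (j₀ + i) + Real.sqrt (fC₂ (j₀ + i))) ^ 2 +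
        fS (j₀ + i) + fT (j₀ + i) + fO (j₀ + i) ≤
      (αT ^ 2 + 2 * αT * ob + (αS + α₁ + β₁ + ψ₁) ^ 2 + (αO + α₂ + β₂ + ψ₂) ^ 2 + φS + φT + φO) * θ ^ i := by
  have ht : 0 ≤ θ ^ i := pow_nonneg hθ0 i
  have ht1 : θ ^ i ≤ 1 := pow_le_one₀ hθ0 hθ1
  -- the three amplitude groups
  set x₁ := wS (j₀ + i) + wC₁ (j₀ + i) + 𝔞₁ (j₀ + i) + Real.sqrt (fC₁ (j₀ + i)) with hx₁
  set x₂ := wO (j₀ + i) + wC₂ (j₀ + i) + 𝔞₂ (j₀ + i) + Real.sqrt (fC₂ (j₀ + i)) with hx₂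
  have hx₁0 : 0 ≤ x₁ := by
    have := hwS0 i; have := hwC₁0 i; have := h𝔞₁0 i; have := Real.sqrt_nonneg (fC₁ (j₀ + i)); positivity
  have hx₂0 : 0 ≤ x₂ := by
    have := hwO0 i; have := hwC₂0 i; have := h𝔞₂0 i; have := Real.sqrt_nonneg (fC₂ (j₀ + i)); positivity
  have hx₁le : x₁ ≤ (αS + α₁ + β₁ + ψ₁) * θ ^ i := by
    have := hwS i; have := hwC₁ i; have := h𝔞₁ i; have := hψ₁ i; rw [hx₁]; linarith
  have hx₂le : x₂ ≤ (αO + α₂ + β₂ + ψ₂) * θ ^ i := by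
    have := hwO i; have := hwC₂ i; have := h𝔞₂ i; have := hψ₂ i; rw [hx₂]; linarith
  -- squares of geometric amplitudes: `(cθ^i)² ≤ c²θ^i`
  have hsq : ∀ {x c : ℝ}, 0 ≤ x → x ≤ c * θ ^ i → x ^ 2 ≤ c ^ 2 * θ ^ i := by
    intro x c hx hxc
    have hc : 0 ≤ c * θ ^ i := hx.trans hxc
    calc x ^ 2 ≤ (c * θ ^ i) ^ 2 := pow_le_pow_left₀ hx hxc 2
      _ = c ^ 2 * θ ^ i * θ ^ i := by ring
      _ ≤ c ^ 2 * θ ^ i * 1 := mul_le_mul_of_nonneg_left ht1 (by positivity)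
      _ = c ^ 2 * θ ^ i := by ring
  have h1 : wT (j₀ + i) ^ 2 ≤ αT ^ 2 * θ ^ i := hsq (hwT0 i) (hwT i)
  have h2 : 2 * wT (j₀ + i) * o (j₀ + i) ≤ 2 * αT * ob * θ ^ i := by
    have hαT : 0 ≤ αT * θ ^ i := (hwT0 i).trans (hwT i)
    have := mul_le_mul (hwT i) (ho i) (ho0 i) hαT
    nlinarith
  have h3 : x₁ ^ 2 ≤ (αS + α₁ + β₁ + ψ₁) ^ 2 * θ ^ i := hsq hx₁0 hx₁le
  have h4 : x₂ ^ 2 ≤ (αO + α₂ + β₂ + ψ₂) ^ 2 * θ ^ i := hsq hx₂0 hx₂le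
  have h5 := hfS i; have h6 := hfT i; have h7 := hfO i
  nlinarith

/-- **Summability and the closed-form tail sum**: under the hypotheses of `resolved_junk_le_geometric` with `θ < 1` and the
increments `e_j ≥ 0` for all `j`, `e` is summable and `Σ'_i e_{j₀+i} ≤ C_e/(1−θ)`. [folklore] -/
theorem summable_and_tsum_le_of_shift_geometric {e : ℕ → ℝ} {j₀ : ℕ} {C θ : ℝ} (hθ0 : 0 ≤ θ) (hθ1 : θ < 1)
    (he0 : ∀ j, 0 ≤ e j) (he : ∀ i, e (j₀ + i) ≤ C * θ ^ i) :
    Summable e ∧ ∑' i, e (j₀ + i) ≤ C / (1 - θ) := by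
  have hgeo : Summable fun i : ℕ => C * θ ^ i := (summable_geometric_of_lt_one hθ0 hθ1).mul_left C
  have hshift : Summable fun i : ℕ => e (j₀ + i) := Summable.of_nonneg_of_le (fun i => he0 _) he hgeo
  have hes : Summable e := by
    rw [← summable_nat_add_iff j₀]
    simpa only [add_comm] using hshift
  refine ⟨hes, ?_⟩
  calc ∑' i, e (j₀ + i) ≤ ∑' i : ℕ, C * θ ^ i := hshift.tsum_le_tsum he hgeo
    _ = C / (1 - θ) := by rw [tsum_mul_left, tsum_geometric_of_lt_one hθ0 hθ1, div_eq_mul_inv]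

/-! ## §2 The closer with the closed-form budget -/

section Cascade

variable (P : CascadeParams)

/-- **`K1Localised P (γ² − 3)` FROM THE RESOLVED LEDGER WITH GEOMETRIC AMPLITUDES** (shape P, `L_min ≥ 1000`): the data of
`k1Localised_of_resolved_ledger` with `hes`/`hbudget` replaced by geometric amplitude bounds from the start phase `j₀`
(`w^•_{j₀+i}, 𝔞^•_{j₀+i}, √f^{C•}_{j₀+i} ≤ (const)θ^i`, `f^{S,T,O}_{j₀+i} ≤ (const)θ^i`, `o_{j₀+i} ≤ ō`, `0 ≤ θ < 1`) and the
CLOSED-FORM budget `S_{j₀} + O_{j₀} + C_e/(1−θ) < ‖datum‖²`,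
`C_e = α_T² + 2α_Tō + (α_S + α₁ + β₁ + ψ₁)² + (α_O + α₂ + β₂ + ψ₂)² + φ_S + φ_T + φ_O`.
[cite: DEIJ2022, (1.2)–(1.3)] [cite: ElgindiLissMattingly2025, §1.2.2 and §3.1] [cite: Grafakos2014, Prop. 3.2.7 (3)] -/
theorem k1Localised_of_resolved_ledger_geometric (hγ : 5 ≤ P.γ) (hγ' : P.γ ≤ 8) (hδ₀ : 0 < P.δ₀)
    (hδ₀' : P.δ₀ ≤ 1 / 4) (hd : P.d = 2) (hN₀ : P.N₀ = 1) (hρN : P.ρN = 2) {Lm : ℝ} (hLm : 1000 ≤ Lm)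
    (a b : ℕ → UnitAddTorus (Fin 2) → ℝ) (has : ∀ j, IsSmooth (a j)) (h0 : a 0 = datum)
    (hb : ∀ j, b j = a j ∘ shearMap 0 1 (amp ⟨P.U j, P.U_periodic j, P.contDiff_U (P.δ_pos hδ₀ (by rw [hd]; norm_num) j)⟩ P.γ))
    (hab : ∀ j, a (j + 1) = b j ∘ shearMap 1 0 (amp ⟨P.U j, P.U_periodic j, P.contDiff_U (P.δ_pos hδ₀ (by rw [hd]; norm_num) j)⟩ P.γ))
    (K : ℕ → ℕ) {c : ℝ} (hc : 0 < c) {u v : ℕ} (huv : (u : ℝ) * P.γ ≤ 13 / 10 * v)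
    (S T O C₁ C₂ A₁ A₂ wS wT wO wC₁ wC₂ 𝔞₁ 𝔞₂ o fS fT fO fC₁ fC₂ : ℕ → ℝ) {j₁ j₀ : ℕ}
    (hcK : ∀ n, j₁ ≤ n → (1 + 1 / 250) * (c * (P.γ ^ 2 - 3) ^ n) ≤ K n)
    (hSn : ∀ n, j₁ ≤ n → ∑' k : Fin 2 → ℤ, (if |k 0| < (K n : ℤ) then (1 : ℝ) else 0) *
        ‖mFourierCoeff (fun x => (a n x : ℂ)) k‖ ^ 2 ≤ S n)
    (hOn : ∀ n, j₁ ≤ n → ∑' k : Fin 2 → ℤ, (if (K n : ℤ) ≤ |k 0| ∧ (u : ℤ) * |k 0| ≤ (v : ℤ) * |k 1| then (1 : ℝ) else 0) *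
        ‖mFourierCoeff (fun x => (a n x : ℂ)) k‖ ^ 2 ≤ O n)
    (h1 : ∀ j, j₀ ≤ j → S (j + 1) ≤ T j + (wS j + Real.sqrt (C₁ j)) ^ 2 + fS j)
    (h2 : ∀ j, j₀ ≤ j → T j ≤ S j + (wT j + Real.sqrt (O j)) ^ 2 + fT j)
    (h3 : ∀ j, j₀ ≤ j → O (j + 1) ≤ (wO j + Real.sqrt (C₂ j)) ^ 2 + fO j)
    (h4 : ∀ j, j₀ ≤ j → C₁ j ≤ (wC₁ j + Real.sqrt (A₁ j)) ^ 2 + fC₁ j)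
    (h5 : ∀ j, j₀ ≤ j → C₂ j ≤ (wC₂ j + Real.sqrt (A₂ j)) ^ 2 + fC₂ j)
    (h𝔞₁ : ∀ j, j₀ ≤ j → Real.sqrt (A₁ j) ≤ 𝔞₁ j) (h𝔞₂ : ∀ j, j₀ ≤ j → Real.sqrt (A₂ j) ≤ 𝔞₂ j)
    (ho : ∀ j, j₀ ≤ j → Real.sqrt (O j) ≤ o j)
    (hO : ∀ j, 0 ≤ O j) (hA₁ : ∀ j, 0 ≤ A₁ j) (hA₂ : ∀ j, 0 ≤ A₂ j) (hwS : ∀ j, 0 ≤ wS j) (hwT : ∀ j, 0 ≤ wT j)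
    (hwO : ∀ j, 0 ≤ wO j) (hwC₁ : ∀ j, 0 ≤ wC₁ j) (hwC₂ : ∀ j, 0 ≤ wC₂ j) (ho0 : ∀ j, 0 ≤ o j) (hfS : ∀ j, 0 ≤ fS j)
    (hfT : ∀ j, 0 ≤ fT j) (hfO : ∀ j, 0 ≤ fO j) (hfC₁ : ∀ j, 0 ≤ fC₁ j) (hfC₂ : ∀ j, 0 ≤ fC₂ j)
    {θ αS αT αO α₁ α₂ β₁ β₂ ψ₁ ψ₂ ob φS φT φO : ℝ} (hθ0 : 0 ≤ θ) (hθ1 : θ < 1)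
    (gwT : ∀ i, wT (j₀ + i) ≤ αT * θ ^ i) (gwS : ∀ i, wS (j₀ + i) ≤ αS * θ ^ i) (gwO : ∀ i, wO (j₀ + i) ≤ αO * θ ^ i)
    (gwC₁ : ∀ i, wC₁ (j₀ + i) ≤ α₁ * θ ^ i) (gwC₂ : ∀ i, wC₂ (j₀ + i) ≤ α₂ * θ ^ i)
    (g𝔞₁ : ∀ i, 𝔞₁ (j₀ + i) ≤ β₁ * θ ^ i) (g𝔞₂ : ∀ i, 𝔞₂ (j₀ + i) ≤ β₂ * θ ^ i)
    (gψ₁ : ∀ i, Real.sqrt (fC₁ (j₀ + i)) ≤ ψ₁ * θ ^ i) (gψ₂ : ∀ i, Real.sqrt (fC₂ (j₀ + i)) ≤ ψ₂ * θ ^ i)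
    (gob : ∀ i, o (j₀ + i) ≤ ob)
    (gfS : ∀ i, fS (j₀ + i) ≤ φS * θ ^ i) (gfT : ∀ i, fT (j₀ + i) ≤ φT * θ ^ i) (gfO : ∀ i, fO (j₀ + i) ≤ φO * θ ^ i)
    (hbudget : S j₀ + O j₀ +
        (αT ^ 2 + 2 * αT * ob + (αS + α₁ + β₁ + ψ₁) ^ 2 + (αO + α₂ + β₂ + ψ₂) ^ 2 + φS + φT + φO) / (1 - θ) <
      Torus.scalarL2Sq datum) :
    K1Localised P (P.γ ^ 2 - 3) := by
  set e : ℕ → ℝ := fun j => wT j ^ 2 + 2 * wT j * o j + (wS j + wC₁ j + 𝔞₁ j + Real.sqrt (fC₁ j)) ^ 2 +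
    (wO j + wC₂ j + 𝔞₂ j + Real.sqrt (fC₂ j)) ^ 2 + fS j + fT j + fO j with he
  set Ce : ℝ := αT ^ 2 + 2 * αT * ob + (αS + α₁ + β₁ + ψ₁) ^ 2 + (αO + α₂ + β₂ + ψ₂) ^ 2 + φS + φT + φO with hCe
  have he0 : ∀ j, 0 ≤ e j := fun j => by
    simp only [he]
    have : 0 ≤ 2 * wT j * o j := by have := hwT j; have := ho0 j; positivity
    nlinarith [sq_nonneg (wT j), sq_nonneg (wS j + wC₁ j + 𝔞₁ j + Real.sqrt (fC₁ j)),
      sq_nonneg (wO j + wC₂ j + 𝔞₂ j + Real.sqrt (fC₂ j)), hfS j, hfT j, hfO j]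
  have h𝔞₁0 : ∀ i, 0 ≤ 𝔞₁ (j₀ + i) := fun i => (Real.sqrt_nonneg _).trans (h𝔞₁ _ (Nat.le_add_right _ _))
  have h𝔞₂0 : ∀ i, 0 ≤ 𝔞₂ (j₀ + i) := fun i => (Real.sqrt_nonneg _).trans (h𝔞₂ _ (Nat.le_add_right _ _))
  have heC : ∀ i, e (j₀ + i) ≤ Ce * θ ^ i := fun i =>
    resolved_junk_le_geometric hθ0 hθ1.le (fun i => hwT _) gwT (fun i => hwS _) gwS (fun i => hwO _) gwO
      (fun i => hwC₁ _) gwC₁ (fun i => hwC₂ _) gwC₂ h𝔞₁0 g𝔞₁ h𝔞₂0 g𝔞₂ gψ₁ gψ₂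
      (fun i => ho0 _) gob gfS gfT gfO i
  obtain ⟨hes, htail⟩ := summable_and_tsum_le_of_shift_geometric (e := e) hθ0 hθ1 he0 heC
  exact k1Localised_of_resolved_ledger P hγ hγ' hδ₀ hδ₀' hd hN₀ hρN hLm a b has h0 hb hab K hc huv S T O C₁ C₂ A₁ A₂
    wS wT wO wC₁ wC₂ 𝔞₁ 𝔞₂ o fS fT fO fC₁ fC₂ hcK hSn hOn h1 h2 h3 h4 h5 h𝔞₁ h𝔞₂ ho hO hA₁ hA₂ hwS hwT hwO hwC₁ hwC₂
    ho0 hfS hfT hfO hfC₁ hfC₂ hes (by linarith)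

end Cascade

end Summit.AnomalousDissipation.AnomalousDissipation.Theorems.SawtoothPulseCascade.K1Ledger.From
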